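import Mathlib
import Literature.NumberTheory.LFunctions.Zhang2022.Section13ZeroSumQuadratic
import Literature.NumberTheory.LFunctions.Zhang2022.Section13ZeroSumHelpers
import Literature.NumberTheory.LFunctions.Zhang2022.Section13MeanSquareL23Neg
import Literature.NumberTheory.LFunctions.Zhang2022.Section7Step7u033Repaired
import HarnessLib

/-!
# Zhang (2022) §13 p. 75, (13.11): the quadratic zero-sum of `L₂L₃` — item Z-L part (2) = `h23`
# `Σ_{ψ∈Ψ₁}Σ_{ρ∈𝔷(ψ)} |L(ρ+β₁,ψ)/L′(ρ,ψ)|·|L(ρ+β₂,ψ)L(ρ+β₃,ψ)|²·|ω(ρ)| ≤ C·P²·𝓛⁴⁵`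

Topic `Literature/NumberTheory/LFunctions/Zhang2022` (Landau–Siegel audit tree; verdict-neutral).
Y. Zhang, *Discrete mean estimates and the Landau–Siegel zero*, arXiv:2211.02515v1 (2022)
[Zhang2022LandauSiegel], §13 p. 75, (13.11) ("Combining (2.34), Cauchy's inequality, Proposition 7.1,
Lemma 5.9, 6.1 and 3.3, we can verify that `𝓔 = o(𝔓)`" — NOT carried out in print; GAP row G-L3t6-3) —
an unrefereed manuscript under adjudication; nothing here asserts or denies its Theorems 1–2.
Lane ZHANG-L WP14, helper under leaf `h1311` `Skeleton.Eq1311Rel c′ c137` (owner zl-w14-p5), planner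
assignment W14-R3(1): this file supplies hypothesis **`h23`** of the assembler's interface
`Typed.Section13.frakE_le_of_zeroSum_bounds` (`Section13Eq1311Terms`) — the one zero-sum of the S1 term
`t₀⁻¹ΣΣ w·|L₂L₃|·|B|` whose mean value is NOT of length `≤ P` and is therefore taken at the large-sieve
scale `P²` (§8 p. 43, `Z22:§8.u013`, "`Σ_{ψ∈Ψ₁}|L(s+β₂,ψ)L(s+β₃,ψ)|² ≪ P²𝓛³⁶`"), which the prefactor
`t₀⁻¹ = 𝓛⁻⁵¹⁹` pays for.

* `zeroSum_L23_sq_le_of_prop22` — for `c′ ≥ 0` with `Skeleton.Prop22 c′` there is `C` such that for all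
  large `D`, under (A),
  `Σ_{ψ∈Ψ₁}Σ_{ρ∈𝔷(ψ)} |L(ρ+β₁,ψ)/L′(ρ,ψ)|·|L(ρ+β₂,ψ)L(ρ+β₃,ψ)|²·|ω(ρ)| ≤ C·P²·𝓛⁴⁵`
  (LHS byte-identical with `h23` of `frakE_le_of_zeroSum_bounds`); `zeroSum_L23_sq_le_of_prop22'` — the
  same with `0 ≤ C` recorded; `zeroSum_L23_sq_le_eventually` — for all sufficiently large `c′`, no `Prop22`
  hypothesis (`Skeleton.prop22_eventually`).

Route (kernel-checked; the G2 template `zeroSum_dirPoly_sq_le_of_prop22` of `Section13ZeroSumQuadratic`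
with the `L`-product in place of the Dirichlet polynomial): per `ψ`, the generic zero-sum bound
`zeroSum_weight_le_of_prop22` (`Section13ZeroSumBound` = the (2.34)/residue conversion + Lemma 5.9 on
`𝒥(±α)`) with the ENTIRE co-factor
`H(s) = L(s+β₂,ψ)L(s+β₃,ψ)·L(1−s−β₂,ψ̄)L(1−s−β₃,ψ̄)`, which at a critical zero `ρ` (`Re ρ = ½`,
Proposition 2.2 (i); `β_j ∈ iℝ`) equals `|L(ρ+β₂,ψ)L(ρ+β₃,ψ)|²` (`L(w,ψ̄) = \overline{L(w̄,ψ)}`,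
`Typed.Section13.LFunction_inv_conj`), while `ω(ρ) > 0` there; on the two lines `σ = ½ ± α`,
`|H(s)| = |L₂L₃(s)|·|L₂L₃(1−s̄)| ≤ ½(|L₂L₃(s)|² + |L₂L₃(1−s̄)|²)` with `1 − s̄` on the OPPOSITE line, so
`Σ_{ψ∈Ψ₁}|H| ≤ C·P²·𝓛³⁶` by `Z22:§8.u013` on BOTH segments (`Typed.Section13.meanSq_L23_le_onJ_both` =
tree `Section8aStatements.step8u013_holds` on `𝒥(α)` + its functional-equation transport to `𝒥(−α)`);
then (7.4) `∫_{𝒥(±α)}|ω||ds| ≤ 2πe^{1/4}` and, for the error term, `H_max = (Z·P⁴)⁴`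
(`norm_LFunction_le_bigP_pow_four`, MV Cor. 10.10 made crude), `#Ψ₁ ≤ 𝔓 ≤ 4P²`, `P¹⁶e^{−𝓛¹⁰/8} ≤ 1`.
Exponent: `9 + 36 = 45` (the Lemma 5.9 conversion `log P = 𝓛⁹` times the §8 mean value `𝓛³⁶`).

Theorems only: no new definition, no new fact, axioms standard. WHAT THIS IS NOT: (13.11) itself, nor any
of the seven other zero-sums (Z-POLY: zl-w14-p3; Z-L part (1) `|L(ρ+β)|²` at the `𝔓`-scale: zl-w14-p2).

## References

* Y. Zhang, arXiv:2211.02515v1 (2022), §13 p. 75 (13.11), tex L3806–L3817; §8 p. 43 (§8.u013),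
  tex L2244–2247; §2 (2.2), (2.15), (2.34); §7 (7.4). [cite: Zhang2022LandauSiegel, §13 (13.11) p.75]
* H. L. Montgomery, R. C. Vaughan, *Multiplicative Number Theory I* (2007), §10.1 Cor. 10.10
  (polynomial growth of `L(s,χ)` in vertical strips). [cite: MontgomeryVaughan2007, §10.1 Cor. 10.10]
-/

noncomputable section

open Complex Real Set Filter Topology MeasureTheory intervalIntegral ComplexConjugate

namespace Literature.NumberTheory.LFunctions.Zhang2022.Typed.Section13

open Skeleton GammaFactor Section8aStatements

/-! ## Small bookkeeping -/

/-- The threshold `D ≥ ⌈e^{L₀}⌉` gives `L₀ ≤ 𝓛`. [folklore] -/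
private theorem le_ell_of_ceil_exp_le {L₀ : ℝ} {D : ℕ} (hD : ⌈Real.exp L₀⌉₊ ≤ D) : L₀ ≤ ell D := by
  have h1 : Real.exp L₀ ≤ D := (Nat.le_ceil _).trans (by exact_mod_cast hD)
  have hD0 : (0 : ℝ) < D := (Real.exp_pos _).trans_le h1
  rw [ell, Real.le_log_iff_exp_le hD0]; exact h1

/-- **Absorption by `e^{−𝓛¹⁰/8}`, `P`-powers only**: `P^a·e^{−𝓛¹⁰/8} ≤ 1` as soon as `8a ≤ 𝓛`
(`P^a = e^{a𝓛⁹}` and `a𝓛⁹ ≤ 𝓛¹⁰/8`). [cite: Zhang2022LandauSiegel, §2 (2.8); §13 p.75] -/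
theorem bigP_pow_mul_exp_neg_le_one {D : ℕ} (a : ℕ) (hL0 : 0 ≤ ell D) (ha : 8 * (a : ℝ) ≤ ell D) :
    bigP D ^ a * Real.exp (-(ell D ^ 10 / 8)) ≤ 1 := by
  have hP : bigP D ^ a = Real.exp (a * ell D ^ 9) := by rw [bigP, ← Real.exp_nat_mul]
  have h9 : 0 ≤ ell D ^ 9 := pow_nonneg hL0 9
  have hkey : (a : ℝ) * ell D ^ 9 ≤ ell D ^ 10 / 8 := by
    have : ell D ^ 10 = ell D ^ 9 * ell D := by ring
    rw [this]; nlinarith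
  rw [hP, ← Real.exp_add]
  exact Real.exp_le_one_iff.mpr (by linarith)

/-- `1 − \overline{(z + s₀ + iv)} = (−z) + s₀ + iv` for real `z, v`: the reflection `s ↦ 1 − s̄` swaps the
two segments `𝒥(±α)`. [cite: Zhang2022LandauSiegel, §8 p.43 ("write `s′ = 1 − s̄`")] -/
theorem one_sub_conj_segment_point {D : ℕ} (z v : ℝ) :
    1 - conj ((z : ℂ) + s0 D + v * I) = ((-z : ℝ) : ℂ) + s0 D + v * I := by
  apply Complex.ext
  · simp [s0_re]; ring
  · simp [s0_im]; ring

/-- At a point of the critical line, `\overline{1 − ρ − ib} = ρ + ib` (`b` real).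
[cite: Zhang2022LandauSiegel, §13 p.74 ("`L(1−ρ−β₃,ψ̄) = \overline{L(ρ+β₃,ψ)}`")] -/
theorem conj_one_sub_sub_of_re_half {ρ : ℂ} (hρ : ρ.re = 1 / 2) (b : ℝ) :
    conj (1 - ρ - (b : ℂ) * I) = ρ + (b : ℂ) * I := by
  apply Complex.ext
  · simp [hρ]; norm_num
  · simp

/-- **The reflected `L`-value as a conjugate**: `L(1−s−ib,ψ̄) = \overline{L(1−s̄+ib,ψ)}` (`b` real;
`Typed.Section13.LFunction_inv_conj`). [cite: Zhang2022LandauSiegel, §13 p.74; §8 p.43] -/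
theorem LFunction_inv_one_sub_sub_eq {D : ℕ} (x : Chr D) (s : ℂ) (b : ℝ) :
    x.ψ⁻¹.LFunction (1 - s - (b : ℂ) * I) = conj (x.ψ.LFunction (1 - conj s + (b : ℂ) * I)) := by
  rw [LFunction_inv_conj x (1 - s - (b : ℂ) * I)]
  congr 2
  apply Complex.ext <;> simp

/-- **`H_max` for one shifted `L`-value**: for `𝓛 ≥ 80`, `ψ ∈ Ψ`, a real shift `|b| ≤ 1`, and `s` with
`|Re s − ½| ≤ ½`, `|Im s − 2πt₀| ≤ 𝓛₁ + 1`: `‖L(s+ib,ψ)‖ ≤ Z·P⁴` (`norm_LFunction_le_bigP_pow_four`).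
[cite: MontgomeryVaughan2007, §10.1 Cor. 10.10] -/
theorem norm_LFunction_shift_le_bigP_pow_four {D : ℕ} (h80 : 80 ≤ ell D) (x : Chr D) {s : ℂ} {b : ℝ}
    (hb : |b| ≤ 1) (hσ : |s.re - 1 / 2| ≤ 1 / 2) (ht : |s.im - 2 * π * t0 D| ≤ ell1 D + 1) :
    ‖x.ψ.LFunction (s + (b : ℂ) * I)‖ ≤ (∑' n : ℕ, ((n + 1 : ℕ) : ℝ) ^ (-(5 / 4 : ℝ))) * bigP D ^ 4 := by
  refine norm_LFunction_le_bigP_pow_four h80 x (by simpa using hσ) ?_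
  have him : (s + (b : ℂ) * I).im = s.im + b := by simp
  rw [him]
  obtain ⟨hb1, hb2⟩ := abs_le.mp hb
  obtain ⟨ht1, ht2⟩ := abs_le.mp ht
  rw [abs_le]; constructor <;> linarith

/-- **`H_max` for one REFLECTED shifted `L`-value**: under the same hypotheses,
`‖L(1−s−ib,ψ̄)‖ ≤ Z·P⁴` (`= ‖L(1−s̄+ib,ψ)‖`, and `1 − s̄` lies in the same box).
[cite: MontgomeryVaughan2007, §10.1 Cor. 10.10] -/
theorem norm_LFunction_inv_reflect_shift_le_bigP_pow_four {D : ℕ} (h80 : 80 ≤ ell D) (x : Chr D)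
    {s : ℂ} {b : ℝ} (hb : |b| ≤ 1) (hσ : |s.re - 1 / 2| ≤ 1 / 2)
    (ht : |s.im - 2 * π * t0 D| ≤ ell1 D + 1) :
    ‖x.ψ⁻¹.LFunction (1 - s - (b : ℂ) * I)‖ ≤
      (∑' n : ℕ, ((n + 1 : ℕ) : ℝ) ^ (-(5 / 4 : ℝ))) * bigP D ^ 4 := by
  rw [LFunction_inv_one_sub_sub_eq, Complex.norm_conj]
  refine norm_LFunction_shift_le_bigP_pow_four h80 x hb ?_ ?_
  · have : (1 - conj s).re = 1 - s.re := by simp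
    rw [this, show 1 - s.re - 1 / 2 = -(s.re - 1 / 2) by ring, abs_neg]; exact hσ
  · have : (1 - conj s).im = s.im := by simp
    rw [this]; exact ht

/-! ## The zero-sum of `L₂L₃` -/

set_option maxHeartbeats 400000 in
/-- **Z-L part (2) = `h23` of `frakE_le_of_zeroSum_bounds`, with `0 ≤ C` recorded.** For `c′ ≥ 0` with
`Skeleton.Prop22 c′` there is `C ≥ 0` such that for all large `D`, every real primitive `χ (mod D)`
satisfying (A):
`Σ_{ψ∈Ψ₁}Σ_{ρ∈𝔷(ψ)} |L(ρ+β₁,ψ)/L′(ρ,ψ)|·|L(ρ+β₂,ψ)L(ρ+β₃,ψ)|²·|ω(ρ)| ≤ C·P²·𝓛⁴⁵` —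
the generic zero-sum bound `zeroSum_weight_le_of_prop22` with
`H = L(·+β₂)L(·+β₃)·L(1−·−β₂,ψ̄)L(1−·−β₃,ψ̄)` (`= |L₂L₃|²` at the critical zeros, Prop. 2.2 (i); `ω(ρ) > 0`),
`|H| ≤ ½(|L₂L₃(s)|² + |L₂L₃(1−s̄)|²)` on `𝒥(±α)`, `Z22:§8.u013` on both segments
(`meanSq_L23_le_onJ_both`), (7.4) for `∫|ω|`, `#Ψ₁ ≤ 𝔓 ≤ 4P²` and `(Z P⁴)⁴·P²…·e^{−𝓛¹⁰/8}`-absorption.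
[cite: Zhang2022LandauSiegel, §13 (13.11) p.75, tex L3806–L3817; §8 p.43 (§8.u013)] -/
theorem zeroSum_L23_sq_le_of_prop22' {c' : ℝ} (hc' : 0 ≤ c') (h22 : Prop22 c') :
    ∃ C : ℝ, 0 ≤ C ∧ ForAllLarge fun D _ χ => AssumptionA D χ →
      (∑ x ∈ finsetOf (PsiOne χ), ∑ ρ ∈ finsetOf (zeroSet D x),
          ‖x.ψ.LFunction (ρ + beta1 c' D) / deriv x.ψ.LFunction ρ‖ *
            ‖x.ψ.LFunction (ρ + beta2 c' D) * x.ψ.LFunction (ρ + beta3 c' D)‖ ^ 2 *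
              ‖omegaW D ρ‖) ≤
        C * bigP D ^ 2 * ell D ^ 45 := by
  obtain ⟨K, hK0, C₇, hC₇, D₁, hW⟩ := zeroSum_weight_le_of_prop22 hc' h22
  obtain ⟨D₂, h22i⟩ := h22.1
  obtain ⟨C₈, D₃, h8⟩ := meanSq_L23_le_onJ_both c'
  obtain ⟨D₄, hP4⟩ := frakP_le_four_mul_bigP_sq
  set Zc : ℝ := ∑' n : ℕ, ((n + 1 : ℕ) : ℝ) ^ (-(5 / 4 : ℝ)) with hZc
  have hZc0 : 0 ≤ Zc := tsum_nonneg fun n => by positivity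
  set C₈' : ℝ := max C₈ 0 with hC₈'
  have hC₈'0 : 0 ≤ C₈' := le_max_right _ _
  refine ⟨2 * (C₇ * (C₈' * (2 * π * Real.exp (1 / 4)))) + 4 * (K * Zc ^ 4), by positivity,
    max (max (max D₁ D₂) (max D₃ D₄))
      (max (max 3 ⌈Real.exp 144⌉₊) (max ⌈Real.exp 3⌉₊ ⌈Real.exp (14 * |c'| * π)⌉₊)),
    fun D _ χ hD hq hp hA => ?_⟩
  have hD₁ : D₁ ≤ D := (le_max_left _ _).trans ((le_max_left _ _).trans ((le_max_left _ _).trans hD))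
  have hD₂ : D₂ ≤ D := (le_max_right _ _).trans ((le_max_left _ _).trans ((le_max_left _ _).trans hD))
  have hD₃ : D₃ ≤ D := (le_max_left _ _).trans ((le_max_right _ _).trans ((le_max_left _ _).trans hD))
  have hD₄ : D₄ ≤ D := (le_max_right _ _).trans ((le_max_right _ _).trans ((le_max_left _ _).trans hD))
  have hD3 : 3 ≤ D := (le_max_left _ _).trans ((le_max_left _ _).trans ((le_max_right _ _).trans hD))
  have hDe : ⌈Real.exp 144⌉₊ ≤ D :=
    (le_max_right _ _).trans ((le_max_left _ _).trans ((le_max_right _ _).trans hD))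
  have hDc : max ⌈Real.exp 3⌉₊ ⌈Real.exp (14 * |c'| * π)⌉₊ ≤ D :=
    (le_max_right _ _).trans ((le_max_right _ _).trans hD)
  have h144 : 144 ≤ ell D := le_ell_of_ceil_exp_le hDe
  have h80 : 80 ≤ ell D := by linarith
  have hℓ1 : 1 < ell D := one_lt_ell hD3
  have hℓpos : 0 < ell D := by linarith
  obtain ⟨hL3, hα0, hb2lt, hb3lt⟩ := shifts_small c' hDc
  obtain ⟨-, he⟩ := ResidueValues.thresholds c' hDc
  obtain ⟨hαpos, hα6, -⟩ := Step8u016.alpha_small hL3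
  obtain ⟨-, e2, e3⟩ := beta_eq_b_mul_I c' D
  -- the shift sizes `|b₂|, |b₃| ≤ 1`
  have hb2 : |b2 c' D| ≤ 1 := by
    have n2 := ResidueValues.norm_beta2_le c' hL3 he
    rw [e2, norm_mul, Complex.norm_I, mul_one, Complex.norm_real, Real.norm_eq_abs] at n2
    linarith
  have hb3 : |b3 c' D| ≤ 1 := by
    have n3 := ResidueValues.norm_beta3_le c' hL3 he
    rw [e3, norm_mul, Complex.norm_I, mul_one, Complex.norm_real, Real.norm_eq_abs] at n3
    linarith
  have hα2 : alpha D ≤ 1 / 2 := by linarith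
  have hℓ1pos : 0 < ell1 D := by rw [ell1]; positivity
  have hℓ2pos : 0 < ell2 D := by rw [ell2]; positivity
  have hℓt : ell1 D < 2 * π * t0 D := by
    have h1 : ell1 D ≤ t0 D := pow_le_pow_right₀ hℓ1.le (by norm_num)
    have h2 : 0 < t0 D := lt_of_lt_of_le hℓ1pos h1
    nlinarith [Real.pi_gt_three]
  have hαℓ2 : |alpha D| ≤ ell2 D := by
    rw [abs_of_pos hαpos, ell2]
    have : (1 : ℝ) ≤ ell D ^ 400 := one_le_pow₀ hℓ1.le
    linarith
  have hαℓ2' : |(-alpha D)| ≤ ell2 D := by rw [abs_neg]; exact hαℓ2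
  have hP0 : 0 ≤ frakP D := frakP_nonneg D
  have hbigP0 : 0 < bigP D := Real.exp_pos _
  -- names
  set T := finsetOf (PsiOne χ) with hT
  set L23 : Chr D → ℂ → ℂ := fun x s =>
    x.ψ.LFunction (s + beta2 c' D) * x.ψ.LFunction (s + beta3 c' D) with hL23
  set H : Chr D → ℂ → ℂ := fun x s =>
    L23 x s * (x.ψ⁻¹.LFunction (1 - s - beta2 c' D) * x.ψ⁻¹.LFunction (1 - s - beta3 c' D)) with hH
  set M : ℝ := Zc * bigP D ^ 4 with hM
  have hM0 : 0 ≤ M := by positivity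
  set Hmax : ℝ := M ^ 4 with hHmax
  have hHmax0 : 0 ≤ Hmax := by positivity
  set Q : ℝ := C₈' * bigP D ^ 2 * ell D ^ 36 with hQ
  have hQ0 : 0 ≤ Q := by positivity
  -- the reflected factor as a conjugate: `L(1−s−β₂,ψ̄)L(1−s−β₃,ψ̄) = conj (L₂L₃(1 − s̄))`
  have hrefl : ∀ x : Chr D, ∀ s : ℂ,
      x.ψ⁻¹.LFunction (1 - s - beta2 c' D) * x.ψ⁻¹.LFunction (1 - s - beta3 c' D) =
        conj (L23 x (1 - conj s)) := by
    intro x s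
    rw [hL23]
    show _ = conj (x.ψ.LFunction (1 - conj s + beta2 c' D) * x.ψ.LFunction (1 - conj s + beta3 c' D))
    rw [map_mul, e2, e3, LFunction_inv_one_sub_sub_eq, LFunction_inv_one_sub_sub_eq]
  -- the co-factor is holomorphic
  have hHdiff : ∀ x : Chr D, ∀ z : ℂ, 0 < z.im → DifferentiableAt ℂ (H x) z := by
    intro x z _
    have hψ : x.ψ ≠ 1 := x.ψ_ne_one
    have hψ' : x.ψ⁻¹ ≠ 1 := inv_ne_one.mpr x.ψ_ne_one
    have hL := DirichletCharacter.differentiable_LFunction hψ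
    have hL' := DirichletCharacter.differentiable_LFunction hψ'
    have h2 : DifferentiableAt ℂ (fun s => x.ψ.LFunction (s + beta2 c' D)) z :=
      (hL.comp (differentiable_id.add (differentiable_const _))) z
    have h3 : DifferentiableAt ℂ (fun s => x.ψ.LFunction (s + beta3 c' D)) z :=
      (hL.comp (differentiable_id.add (differentiable_const _))) z
    have h2' : DifferentiableAt ℂ (fun s => x.ψ⁻¹.LFunction (1 - s - beta2 c' D)) z :=
      (hL'.comp (((differentiable_const _).sub differentiable_id).sub (differentiable_const _))) z
    have h3' : DifferentiableAt ℂ (fun s => x.ψ⁻¹.LFunction (1 - s - beta3 c' D)) z :=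
      (hL'.comp (((differentiable_const _).sub differentiable_id).sub (differentiable_const _))) z
    exact (h2.mul h3).mul (h2'.mul h3')
  -- and bounded by `Hmax` on the strip
  have hHb : ∀ x : Chr D, ∀ s : ℂ, |s.re - 1 / 2| ≤ alpha D → |s.im - 2 * π * t0 D| ≤ ell1 D + 1 →
      ‖H x s‖ ≤ Hmax := by
    intro x s hσ hτ
    have hσ' : |s.re - 1 / 2| ≤ 1 / 2 := hσ.trans hα2
    have g2 : ‖x.ψ.LFunction (s + beta2 c' D)‖ ≤ M := by
      rw [e2]; exact norm_LFunction_shift_le_bigP_pow_four h80 x hb2 hσ' hτ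
    have g3 : ‖x.ψ.LFunction (s + beta3 c' D)‖ ≤ M := by
      rw [e3]; exact norm_LFunction_shift_le_bigP_pow_four h80 x hb3 hσ' hτ
    have g2' : ‖x.ψ⁻¹.LFunction (1 - s - beta2 c' D)‖ ≤ M := by
      rw [e2]; exact norm_LFunction_inv_reflect_shift_le_bigP_pow_four h80 x hb2 hσ' hτ
    have g3' : ‖x.ψ⁻¹.LFunction (1 - s - beta3 c' D)‖ ≤ M := by
      rw [e3]; exact norm_LFunction_inv_reflect_shift_le_bigP_pow_four h80 x hb3 hσ' hτ
    rw [hH, hL23]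
    show ‖x.ψ.LFunction (s + beta2 c' D) * x.ψ.LFunction (s + beta3 c' D) *
        (x.ψ⁻¹.LFunction (1 - s - beta2 c' D) * x.ψ⁻¹.LFunction (1 - s - beta3 c' D))‖ ≤ Hmax
    rw [norm_mul, norm_mul, norm_mul, hHmax,
      show M ^ 4 = M * M * (M * M) by ring]
    exact mul_le_mul (mul_le_mul g2 g3 (norm_nonneg _) hM0)
      (mul_le_mul g2' g3' (norm_nonneg _) hM0) (by positivity) (by positivity)
  -- per character: the real zero-sum is the norm of the complex one, bounded by `hW`
  have hx : ∀ x ∈ T,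
      (∑ ρ ∈ finsetOf (zeroSet D x),
          ‖x.ψ.LFunction (ρ + beta1 c' D) / deriv x.ψ.LFunction ρ‖ * ‖L23 x ρ‖ ^ 2 *
            ‖omegaW D ρ‖) ≤
        C₇ * ell D ^ 9 *
            ((∫ v in (-ell1 D)..ell1 D,
                ‖H x ((alpha D : ℂ) + s0 D + v * I)‖ * ‖omegaW D ((alpha D : ℂ) + s0 D + v * I)‖) +
              (∫ v in (-ell1 D)..ell1 D,
                ‖H x (((-alpha D : ℝ) : ℂ) + s0 D + v * I)‖ *
                  ‖omegaW D (((-alpha D : ℝ) : ℂ) + s0 D + v * I)‖)) +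
          K * Hmax * Real.exp (-(ell D ^ 10 / 8)) := by
    intro x hxT
    have hxΨ : x ∈ PsiOne χ := mem_of_mem_finsetOf hxT
    have hWx := hW D χ hD₁ hq hp x hxΨ (H x) Hmax hHmax0 (hHdiff x) (hHb x)
    have hfin : (zeroSet D x).Finite := zerosFinite_holds D x
    -- the complex sum is the real sum
    have hsum : (∑ ρ ∈ finsetOf (zeroSet D x),
        ((‖x.ψ.LFunction (ρ + beta1 c' D) / deriv x.ψ.LFunction ρ‖ : ℝ) : ℂ) * H x ρ * omegaW D ρ) =
        (((∑ ρ ∈ finsetOf (zeroSet D x),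
          ‖x.ψ.LFunction (ρ + beta1 c' D) / deriv x.ψ.LFunction ρ‖ * ‖L23 x ρ‖ ^ 2 *
            ‖omegaW D ρ‖ : ℝ)) : ℂ) := by
      push_cast
      refine Finset.sum_congr rfl fun ρ hρ => ?_
      have hρz : ρ ∈ zeroSet D x := (mem_finsetOf hfin).mp hρ
      have hre : ρ.re = 1 / 2 :=
        h22i D χ hD₂ hq hp x hxΨ ρ (mem_prodZeroSetOmega_of_mem_zeroSet χ hρz)
      obtain ⟨hωre, hωim⟩ := omegaW_re_pos hD3 hre
      have hω : omegaW D ρ = ((‖omegaW D ρ‖ : ℝ) : ℂ) := by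
        have h1 : omegaW D ρ = (((omegaW D ρ).re : ℝ) : ℂ) :=
          Complex.ext (by simp) (by simp [hωim])
        have h2 : ‖omegaW D ρ‖ = (omegaW D ρ).re := by
          rw [h1, Complex.norm_real, Real.norm_of_nonneg hωre.le]; simp
        rw [h2]; exact h1
      have hHρ : H x ρ = ((‖L23 x ρ‖ ^ 2 : ℝ) : ℂ) := by
        rw [hH]
        show L23 x ρ * (x.ψ⁻¹.LFunction (1 - ρ - beta2 c' D) *
            x.ψ⁻¹.LFunction (1 - ρ - beta3 c' D)) = ((‖L23 x ρ‖ ^ 2 : ℝ) : ℂ)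
        have h1 : 1 - conj ρ = ρ := Complex.ext (by simp [hre]; norm_num) (by simp)
        rw [hrefl x ρ, h1, Complex.mul_conj', Complex.ofReal_pow]
      rw [hHρ]
      conv_lhs => rw [hω]
      push_cast
      ring
    have hreal : ‖(∑ ρ ∈ finsetOf (zeroSet D x),
        ((‖x.ψ.LFunction (ρ + beta1 c' D) / deriv x.ψ.LFunction ρ‖ : ℝ) : ℂ) * H x ρ * omegaW D ρ)‖ =
        ∑ ρ ∈ finsetOf (zeroSet D x),
          ‖x.ψ.LFunction (ρ + beta1 c' D) / deriv x.ψ.LFunction ρ‖ * ‖L23 x ρ‖ ^ 2 *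
            ‖omegaW D ρ‖ := by
      rw [hsum, Complex.norm_real, Real.norm_of_nonneg]
      exact Finset.sum_nonneg fun ρ _ => by positivity
    rw [← hreal]
    exact hWx
  -- the line integrals, summed over `Ψ₁`: `Z22:§8.u013` on both segments and (7.4)
  have hline : ∀ z : ℝ, (z = alpha D ∨ z = -alpha D) →
      (∑ x ∈ T, ∫ v in (-ell1 D)..ell1 D,
          ‖H x ((z : ℂ) + s0 D + v * I)‖ * ‖omegaW D ((z : ℂ) + s0 D + v * I)‖) ≤
        Q * (2 * π * Real.exp (1 / 4)) := by
    intro z hz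
    have hzabs : |z| ≤ ell2 D := by
      rcases hz with h | h
      · rw [h]; exact hαℓ2
      · rw [h]; exact hαℓ2'
    have hz' : (-z) = alpha D ∨ (-z) = -alpha D := by
      rcases hz with h | h
      · exact Or.inr (by rw [h])
      · exact Or.inl (by rw [h, neg_neg])
    -- continuity of the integrands
    have hcont : ∀ x : Chr D, ContinuousOn (fun v : ℝ =>
        ‖H x ((z : ℂ) + s0 D + v * I)‖ * ‖omegaW D ((z : ℂ) + s0 D + v * I)‖)
        (Icc (-ell1 D) (ell1 D)) := fun x =>
      continuousOn_normH_mul_normOmega (D := D) (H x) (hHdiff x) z hℓt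
    have hint : ∀ x ∈ T, IntervalIntegrable (fun v : ℝ =>
        ‖H x ((z : ℂ) + s0 D + v * I)‖ * ‖omegaW D ((z : ℂ) + s0 D + v * I)‖) volume
        (-ell1 D) (ell1 D) := fun x _ =>
      ((hcont x).mono (by rw [Set.uIcc_of_le (by linarith)])).intervalIntegrable
    rw [← intervalIntegral.integral_finsetSum hint]
    -- pointwise bound on the line
    have hpt : ∀ v ∈ Icc (-ell1 D) (ell1 D),
        (∑ x ∈ T, ‖H x ((z : ℂ) + s0 D + v * I)‖ * ‖omegaW D ((z : ℂ) + s0 D + v * I)‖) ≤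
          Q * ‖omegaW D ((z : ℂ) + s0 D + v * I)‖ := by
      intro v hv
      have hvabs : |v| ≤ ell1 D := abs_le.mpr ⟨hv.1, hv.2⟩
      set s : ℂ := (z : ℂ) + s0 D + v * I with hs
      set s' : ℂ := ((-z : ℝ) : ℂ) + s0 D + v * I with hs'
      have hss' : 1 - conj s = s' := one_sub_conj_segment_point (D := D) z v
      rw [← Finset.sum_mul]
      refine mul_le_mul_of_nonneg_right ?_ (norm_nonneg _)
      -- `Σ_ψ |H(s)| ≤ ½ Σ_ψ (|L₂L₃(s)|² + |L₂L₃(s′)|²)`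
      have hHle : ∀ x : Chr D, ‖H x s‖ ≤ (‖L23 x s‖ ^ 2 + ‖L23 x s'‖ ^ 2) / 2 := by
        intro x
        rw [hH]
        show ‖L23 x s * (x.ψ⁻¹.LFunction (1 - s - beta2 c' D) *
            x.ψ⁻¹.LFunction (1 - s - beta3 c' D))‖ ≤ _
        rw [hrefl x s, hss', norm_mul, Complex.norm_conj]
        nlinarith [two_mul_le_add_sq ‖L23 x s‖ ‖L23 x s'‖, norm_nonneg (L23 x s),
          norm_nonneg (L23 x s')]
      have hon : onJ D z s := ⟨v, hvabs, rfl⟩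
      have hon' : onJ D (-z) s' := ⟨v, hvabs, rfl⟩
      have h1 : ∑ x ∈ T, ‖L23 x s‖ ^ 2 ≤ C₈ * bigP D ^ 2 * ell D ^ 36 :=
        h8 D χ hD₃ hq hp hA z hz s hon
      have h2 : ∑ x ∈ T, ‖L23 x s'‖ ^ 2 ≤ C₈ * bigP D ^ 2 * ell D ^ 36 :=
        h8 D χ hD₃ hq hp hA (-z) hz' s' hon'
      have hCQ : C₈ * bigP D ^ 2 * ell D ^ 36 ≤ Q := by
        rw [hQ]
        have : 0 ≤ bigP D ^ 2 * ell D ^ 36 := by positivity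
        nlinarith [le_max_left C₈ 0]
      calc ∑ x ∈ T, ‖H x s‖ ≤ ∑ x ∈ T, (‖L23 x s‖ ^ 2 + ‖L23 x s'‖ ^ 2) / 2 :=
            Finset.sum_le_sum fun x _ => hHle x
        _ = ((∑ x ∈ T, ‖L23 x s‖ ^ 2) + ∑ x ∈ T, ‖L23 x s'‖ ^ 2) / 2 := by
            rw [← Finset.sum_add_distrib, Finset.sum_div]
        _ ≤ (Q + Q) / 2 := by gcongr <;> linarith
        _ = Q := by ring
    -- integrate
    have hωcont : Continuous fun v : ℝ => ‖omegaW D ((z : ℂ) + s0 D + v * I)‖ :=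
      ((Ded81Edge.continuous_omega (ell2 D) (t0 D)).comp
        (by fun_prop : Continuous fun v : ℝ => (z : ℂ) + s0 D + v * I)).norm
    have hint2 : IntervalIntegrable (fun v : ℝ => Q * ‖omegaW D ((z : ℂ) + s0 D + v * I)‖)
        volume (-ell1 D) (ell1 D) := (continuous_const.mul hωcont).intervalIntegrable _ _
    have hintS : IntervalIntegrable (fun v : ℝ => ∑ x ∈ T,
        ‖H x ((z : ℂ) + s0 D + v * I)‖ * ‖omegaW D ((z : ℂ) + s0 D + v * I)‖) volume
        (-ell1 D) (ell1 D) := by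
      refine (continuousOn_finsetSum T fun x _ => hcont x).mono ?_ |>.intervalIntegrable
      rw [Set.uIcc_of_le (by linarith)]
    have hmono := intervalIntegral.integral_mono_on (by linarith : -ell1 D ≤ ell1 D) hintS hint2 hpt
    refine hmono.trans ?_
    rw [intervalIntegral.integral_const_mul]
    have hω74 : ∫ v in (-ell1 D)..ell1 D, ‖omegaW D ((z : ℂ) + s0 D + v * I)‖ ≤
        2 * π * Real.exp (1 / 4) := by
      have h := SmoothWeight.integral_norm_omega_segment_le_of_abs_le hℓ2pos (t0 D) hzabs hℓ1pos.le
      simpa only [omegaW, s0] using h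
    exact mul_le_mul_of_nonneg_left hω74 hQ0
  -- the error term: `#Ψ₁ ≤ 𝔓 ≤ 4P²`, `Hmax = Z⁴P¹⁶`, `P¹⁶e^{−𝓛¹⁰/8} ≤ 1`
  have hcard : (T.card : ℝ) ≤ frakP D := cardPsiOneLe_holds D χ
  have hfrakP : frakP D ≤ 4 * bigP D ^ 2 := hP4 D hD₄
  have habs : bigP D ^ 16 * Real.exp (-(ell D ^ 10 / 8)) ≤ 1 :=
    bigP_pow_mul_exp_neg_le_one 16 hℓpos.le (by norm_num; linarith)
  have herr : (T.card : ℝ) * (K * Hmax * Real.exp (-(ell D ^ 10 / 8))) ≤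
      4 * (K * Zc ^ 4) * bigP D ^ 2 * ell D ^ 45 := by
    have hℓ45 : (1 : ℝ) ≤ ell D ^ 45 := one_le_pow₀ hℓ1.le
    have h1 : (T.card : ℝ) * (K * Hmax * Real.exp (-(ell D ^ 10 / 8))) ≤
        4 * bigP D ^ 2 * (K * Hmax * Real.exp (-(ell D ^ 10 / 8))) :=
      mul_le_mul_of_nonneg_right (hcard.trans hfrakP) (by positivity)
    have h2 : Hmax * Real.exp (-(ell D ^ 10 / 8)) ≤ Zc ^ 4 := by
      rw [hHmax, hM, mul_pow, ← pow_mul, show 4 * 4 = 16 by norm_num, mul_assoc]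
      exact (mul_le_mul_of_nonneg_left habs (by positivity)).trans (le_of_eq (mul_one _))
    calc (T.card : ℝ) * (K * Hmax * Real.exp (-(ell D ^ 10 / 8)))
        ≤ 4 * bigP D ^ 2 * (K * (Hmax * Real.exp (-(ell D ^ 10 / 8)))) := by
          rw [← mul_assoc K]; exact h1
      _ ≤ 4 * bigP D ^ 2 * (K * Zc ^ 4) :=
          mul_le_mul_of_nonneg_left (mul_le_mul_of_nonneg_left h2 hK0) (by positivity)
      _ = 4 * (K * Zc ^ 4) * bigP D ^ 2 * 1 := by ring
      _ ≤ 4 * (K * Zc ^ 4) * bigP D ^ 2 * ell D ^ 45 :=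
          mul_le_mul_of_nonneg_left hℓ45 (by positivity)
  -- assemble
  calc (∑ x ∈ T, ∑ ρ ∈ finsetOf (zeroSet D x),
          ‖x.ψ.LFunction (ρ + beta1 c' D) / deriv x.ψ.LFunction ρ‖ * ‖L23 x ρ‖ ^ 2 * ‖omegaW D ρ‖)
      ≤ ∑ x ∈ T, (C₇ * ell D ^ 9 *
            ((∫ v in (-ell1 D)..ell1 D,
                ‖H x ((alpha D : ℂ) + s0 D + v * I)‖ * ‖omegaW D ((alpha D : ℂ) + s0 D + v * I)‖) +
              (∫ v in (-ell1 D)..ell1 D,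
                ‖H x (((-alpha D : ℝ) : ℂ) + s0 D + v * I)‖ *
                  ‖omegaW D (((-alpha D : ℝ) : ℂ) + s0 D + v * I)‖)) +
          K * Hmax * Real.exp (-(ell D ^ 10 / 8))) := Finset.sum_le_sum hx
    _ = C₇ * ell D ^ 9 *
          ((∑ x ∈ T, ∫ v in (-ell1 D)..ell1 D,
              ‖H x ((alpha D : ℂ) + s0 D + v * I)‖ * ‖omegaW D ((alpha D : ℂ) + s0 D + v * I)‖) +
            (∑ x ∈ T, ∫ v in (-ell1 D)..ell1 D,
              ‖H x (((-alpha D : ℝ) : ℂ) + s0 D + v * I)‖ *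
                ‖omegaW D (((-alpha D : ℝ) : ℂ) + s0 D + v * I)‖)) +
          T.card * (K * Hmax * Real.exp (-(ell D ^ 10 / 8))) := by
        rw [Finset.sum_add_distrib, Finset.sum_const, nsmul_eq_mul, ← Finset.mul_sum,
          Finset.sum_add_distrib]
    _ ≤ C₇ * ell D ^ 9 * (Q * (2 * π * Real.exp (1 / 4)) + Q * (2 * π * Real.exp (1 / 4))) +
          4 * (K * Zc ^ 4) * bigP D ^ 2 * ell D ^ 45 := by
        have hαc : ((alpha D : ℝ) : ℂ) = (alpha D : ℂ) := rfl
        gcongr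
        · exact hline (alpha D) (Or.inl rfl)
        · exact hline (-alpha D) (Or.inr rfl)
    _ = (2 * (C₇ * (C₈' * (2 * π * Real.exp (1 / 4)))) + 4 * (K * Zc ^ 4)) *
          bigP D ^ 2 * ell D ^ 45 := by
        rw [hQ]; ring

/-- **Z-L part (2) = `h23` of `Typed.Section13.frakE_le_of_zeroSum_bounds` (planner W14-R3(1) shape).**
For `c′ ≥ 0` with `Skeleton.Prop22 c′` there is `C` such that for all large `D`, under (A),
`Σ_{ψ∈Ψ₁}Σ_{ρ∈𝔷(ψ)} |L(ρ+β₁,ψ)/L′(ρ,ψ)|·|L(ρ+β₂,ψ)L(ρ+β₃,ψ)|²·|ω(ρ)| ≤ C·P²·𝓛⁴⁵`.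
[cite: Zhang2022LandauSiegel, §13 (13.11) p.75, tex L3806–L3817; §8 p.43 (§8.u013)] -/
theorem zeroSum_L23_sq_le_of_prop22 {c' : ℝ} (hc' : 0 ≤ c') (h22 : Prop22 c') :
    ∃ C : ℝ, ForAllLarge fun D _ χ => AssumptionA D χ →
      (∑ x ∈ finsetOf (PsiOne χ), ∑ ρ ∈ finsetOf (zeroSet D x),
          ‖x.ψ.LFunction (ρ + beta1 c' D) / deriv x.ψ.LFunction ρ‖ *
            ‖x.ψ.LFunction (ρ + beta2 c' D) * x.ψ.LFunction (ρ + beta3 c' D)‖ ^ 2 *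
              ‖omegaW D ρ‖) ≤
        C * bigP D ^ 2 * ell D ^ 45 := by
  obtain ⟨C, -, h⟩ := zeroSum_L23_sq_le_of_prop22' hc' h22
  exact ⟨C, h⟩

/-- **The `L₂L₃` zero-sum bound for every sufficiently large `c′`, NO `Prop22` hypothesis**
(Proposition 2.2 is a tree theorem for large `c′`: `Skeleton.prop22_eventually`).
[cite: Zhang2022LandauSiegel, §13 (13.11) p.75; §2 Prop. 2.2] -/
theorem zeroSum_L23_sq_le_eventually : ∃ c₀ : ℝ, 0 ≤ c₀ ∧ ∀ c' : ℝ, c₀ ≤ c' →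
    ∃ C : ℝ, 0 ≤ C ∧ ForAllLarge fun D _ χ => AssumptionA D χ →
      (∑ x ∈ finsetOf (PsiOne χ), ∑ ρ ∈ finsetOf (zeroSet D x),
          ‖x.ψ.LFunction (ρ + beta1 c' D) / deriv x.ψ.LFunction ρ‖ *
            ‖x.ψ.LFunction (ρ + beta2 c' D) * x.ψ.LFunction (ρ + beta3 c' D)‖ ^ 2 *
              ‖omegaW D ρ‖) ≤
        C * bigP D ^ 2 * ell D ^ 45 := by
  obtain ⟨c₀, hc₀, h⟩ := prop22_eventually
  exact ⟨c₀, hc₀, fun c' hc' => zeroSum_L23_sq_le_of_prop22' (hc₀.trans hc') (h c' hc')⟩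

end Literature.NumberTheory.LFunctions.Zhang2022.Typed.Section13

end
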